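/-
Copyright (c) 2026 the pub-hodgecm-mathlib formalisation cell (harness21).  Prover seat hodgecm-mathlib-K2E1-p09 (g6), Track B ∕ K2-LIT, h413 =
`stmt-HodgeConjecture-24833`, ENGINE E1, campaign «EIS-R7-BL-SPH-3» (the `N = 3` clone), deal (62) of the dealer K2E1-plan (g6) 2026-09-04T10:20:27Z
(«CLOSER₃ (c) `K2E1SphericalEisensteinMeromorphicU3` `sphericalEisenstein_meromorphic_cm_three_of_hK1` — N = 3 twin of ★ closer₂ ED.1 p859271 over ★ (a) p859281 + ★ (b) p859301 + ★ kit₃»).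
-/
import Summits.HodgeConjecture.HodgeConjecture.Theorems.K2E1BLMeromorphicGluingOfLt                       -- ★ (a) p859281 (K2E1-p10): `sphericalEisenstein_meromorphic_of_eventually_balls_cm_three`
import Summits.HodgeConjecture.HodgeConjecture.Theorems.K2E1SphericalEisensteinMeromorphicBallOfLtU       -- ★ (b) p859301 (K2E1-p10): `sphericalEisenstein_meromorphicOn_ball_of_letters_of_lt (σ₀ ρ₀)`
import Summits.HodgeConjecture.HodgeConjecture.Theorems.K2E1SphericalEisensteinMeromorphicConvDataCMThree -- ★ p859304 (K2E2-p12): `exists_convData_cm_three` (`h_i = η_i ∗ η_i`, k = n + 4)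
import Summits.HodgeConjecture.HodgeConjecture.Theorems.K2E1BLConstantTermVectorsU3                     -- ★ p859130 (K2E4-p14): `exists_constantTermVectors_two_sub` (`α₂ = [H^{2−z}]`)
import Summits.HodgeConjecture.HodgeConjecture.Theorems.K2E1SphericalEisensteinSolvesXSystemU3Head        -- ★ p859134 (this seat): S1₃; brings ★ p859104 S2₃
import Summits.HodgeConjecture.HodgeConjecture.Theorems.K2E1BLEisensteinMemHXCMThree                    -- ★ p859066 (this seat): (b1)₃ letter-free
import Summits.HodgeConjecture.HodgeConjecture.Theorems.K2E1BLUniquenessHunqCM                          -- ★ p859172 (K2E1-p02): `hunq_cm_three` (+ ★ payer `hδα₂`)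
import Summits.HodgeConjecture.HodgeConjecture.Theorems.K2E1BLEvaluationFunctionalCMThree               -- ★ p859226 (K2E1-p08): `exists_evalCLM_eisenstein_cm_three`
import Summits.HodgeConjecture.HodgeConjecture.Theorems.K2E1SphericalEisensteinMeromorphicSuppliersU3     -- ★ p859137 (this seat): `measure_setOf_lt_ne_top_cm_three`; brings ★ ι₃
import Summits.HodgeConjecture.HodgeConjecture.Theorems.K2E1BLFibreAverageInvarianceU                   -- ★ p858957 (K2E1-p08): `hdis'` as a theorem (every rank)
import Summits.HodgeConjecture.HodgeConjecture.Theorems.K2E1IntertwinedSectionInvariance                -- ★ `map_conj_toAdelic_eq_self_three` (`hconj` at `N = 3`)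
import Summits.HodgeConjecture.HodgeConjecture.Theorems.K2E1TruncatedCuspDecayHK1CMThree               -- ★ p859351∕p859367 (K2E1-p13 g0): `hK1_cm_three` — THE letter `hK1`, PAID (ED. 2)
import HarnessLib

/-!
# K2·E1 — `K2E1SphericalEisensteinMeromorphicU3` (P8 PROPER AT `N = 3`, THE CLOSER₃, ED. 1): THE WHOLE-PLANE MEROMORPHIC CONTINUATION OF THE SPHERICAL BOREL EISENSTEIN SERIES ON
# `U(2,1)_{L/L⁺}` VIA BERNSTEIN–LAPID — HYPOTHESIS-FIRST ON THE SINGLE LETTER `hK1` [arXiv:1911.02342, Thm 2.3, §2.4, §4 Claims 1–5 (pp. 9–10)]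

Track B ∕ K2-LIT, crux h413 = `stmt-HodgeConjecture-24833`, route of record `HCCMUnconditional`; cell `hodgecm-mathlib`, squad K2, ENGINE E1 (campaign «EIS-R7-BL», the BL-SPH-3 clone).
Prover seat `hodgecm-mathlib-K2E1-p09` (g6) (provisional owner by ruling (62)).  THEOREMS ONLY (no `def`, no `instance`, no notation, no named-fact `def … : Prop` hypothesis, no
`sorry`); lane `--supports stmt-HodgeConjecture-24833 --as helper` (count-neutral).  Closes no socket.

The `N = 3` twin of ★ closer₂ ED. 1 `K2E1SphericalEisensteinMeromorphicU2.sphericalEisenstein_meromorphic_cm_two_of_hK1` (K2E3-p12 (g7), p859271), proof term line for line with the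
`N = 3` kit: Godement half-plane `{2 < Re z}`, second exponent `H^{2−z}` (`(σ₀, ρ₀) = (2, 2)`), weight `k = n + 4`, balls `n ≥ 1` (the ball `n = 0` does not meet `{2 < Re}`): ★ (a)
`sphericalEisenstein_meromorphic_of_eventually_balls_cm_three` (exhaustion by the balls `n ≥ 1` + normal-form gluing), ★ (b) `sphericalEisenstein_meromorphicOn_ball_of_letters_of_lt 2 2`
(one ball from the letters), ★ `exists_convData_cm_three` (ball data, `h_i = η_i ∗ η_i`), ★ `exists_constantTermVectors_two_sub` (`α₁ = [H^z]`, `α₂ = [H^{2−z}]`), ★ (b1)₃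
`eisensteinSeriesU_flatSectionU_memHX_cm_three` (no trace-zero datum at `N = 3`), ★ S1₃ `shiftOperatorX_toHX_eisensteinSeriesU_eq_smul_cm_three`, ★ S2₃
`exists_cnstN_iota_toHX_eisensteinSeriesU_eq_cm_three` with `hdis'` ★ `integral_zFun_borelConstantTerm_eq_of_unfolding` (`hconj` ★ `map_conj_toAdelic_eq_self_three`), ★ P6′₃ `hunq_cm_three`
(`0 < n`) with `hδα₂` ★ `exists_ae_norm_deltaShift_le_of_ae_eq_cpow`, ★ P3-D₃ `exists_evalCLM_eisenstein_cm_three`, ★ ι₃ `iotaBound_cm_three`∕`isFiniteMeasure_weightedTruncMeasure_cm_three`, ★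
`measure_setOf_lt_ne_top_cm_three`.  THE SINGLE NON-STRUCTURAL LETTER **`hK1`** = K2's cusp-decay estimate at `N = 3` in the SAME universal-in-`η` shape as closer₂'s (its HIGH half is ★
p859333 `K2E1TruncatedCuspDecayHNU3OfUnfolding` mod `hcnst₃`; its BAND half is BAND₃ (41); ED. 2 will discharge it by `hK1_cm_three`, K2E1-p13).
MILESTONE LABEL: «(R7-sph)₃ modulo hK1₃».
HONEST LABEL: HC_CM is proved only modulo the 7 printed citations (2 remaining named inputs: hLiu418 = `stmt-HodgeConjecture-24832`, h413 = `stmt-HodgeConjecture-24833`) until rung 0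
closes; this file asserts no named fact and closes no socket; count-neutral.
References: [BernsteinLapid2019] J. Bernstein, E. Lapid, *On the meromorphic continuation of Eisenstein series*, arXiv:1911.02342 (JAMS 37 (2024)), Thm 2.3, §2.4, §4 Claims 1–5 pp. 9–10;
[Langlands1976] R. P. Langlands, *On the Functional Equations Satisfied by Eisenstein Series*, LNM 544, §7; [MoeglinWaldspurger1995] C. Mœglin, J.-L. Waldspurger, *Spectral Decomposition and
Eisenstein Series*, CUP, IV.1.8–IV.1.10.
-/

set_option autoImplicit false
-- the mandated namespace repeats the single-problem summit's segment (`HodgeConjecture.HodgeConjecture`)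
set_option linter.dupNamespace false

noncomputable section

open MeasureTheory Filter Topology Set NumberField
open scoped NNReal ENNReal Classical ComplexConjugate
open Literature.MeasureTheory.Group Literature.NumberTheory Literature.NumberTheory.Automorphic Literature.NumberTheory.Automorphic.UnitaryGroup AdelicGroupData
open Summit.HodgeConjecture.HodgeConjecture.Cruxes.H413.K2E1BorelEisensteinU
open Summit.HodgeConjecture.HodgeConjecture.Cruxes.H413.K2E1BLBorelSpacesU2Defs
open Summit.HodgeConjecture.HodgeConjecture.Cruxes.H413.K2E1BLBorelOperatorsU2Defs
open Summit.HodgeConjecture.HodgeConjecture.Cruxes.H413.K2E1BLIotaClosedEmbeddingU3 (iotaBound_cm_three isFiniteMeasure_weightedTruncMeasure_cm_three)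
open Summit.HodgeConjecture.HodgeConjecture.Cruxes.H413.K2E1BLQuotientMeasureU (measurePreserving_rightShift_of_unfolding)
open Summit.HodgeConjecture.HodgeConjecture.Cruxes.H413.K2E1SphericalEisensteinMeromorphicSuppliersU3 (measure_setOf_lt_ne_top_cm_three)
open Summit.HodgeConjecture.HodgeConjecture.Cruxes.H413.K2E1SphericalEisensteinMeromorphicConvDataCMThree (exists_convData_cm_three)
open Summit.HodgeConjecture.HodgeConjecture.Cruxes.H413.K2E1BLConstantTermVectorsU3 (exists_constantTermVectors_two_sub)
open Summit.HodgeConjecture.HodgeConjecture.Cruxes.H413.K2E1BLEisensteinMemHXCMThree (eisensteinSeriesU_flatSectionU_memHX_cm_three)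
open Summit.HodgeConjecture.HodgeConjecture.Cruxes.H413.K2E1SphericalEisensteinSolvesXSystemU3 (shiftOperatorX_toHX_eisensteinSeriesU_eq_smul_cm_three exists_cnstN_iota_toHX_eisensteinSeriesU_eq_cm_three)
open Summit.HodgeConjecture.HodgeConjecture.Cruxes.H413.K2E1BLFibreAverageInvarianceU (integral_zFun_borelConstantTerm_eq_of_unfolding)
open Summit.HodgeConjecture.HodgeConjecture.Cruxes.H413.K2E1IntertwinedSectionInvariance (map_conj_toAdelic_eq_self_three)
open Summit.HodgeConjecture.HodgeConjecture.Cruxes.H413.K2E1BLUniquenessHunqCM (hunq_cm_three)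
open Summit.HodgeConjecture.HodgeConjecture.Cruxes.H413.K2E1BLHomogeneousL2U2 (exists_ae_norm_deltaShift_le_of_ae_eq_cpow)
open Summit.HodgeConjecture.HodgeConjecture.Cruxes.H413.K2E1BLEvaluationFunctionalCMThree (exists_evalCLM_eisenstein_cm_three)
open Summit.HodgeConjecture.HodgeConjecture.Cruxes.H413.K2E1SphericalEisensteinMeromorphicBallOfLtU (sphericalEisenstein_meromorphicOn_ball_of_letters_of_lt)
open Summit.HodgeConjecture.HodgeConjecture.Cruxes.H413.K2E1BLMeromorphicGluingOfLt (sphericalEisenstein_meromorphic_of_eventually_balls_cm_three)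

namespace Summit.HodgeConjecture.HodgeConjecture.Cruxes.H413.K2E1SphericalEisensteinMeromorphicU3

variable (L : Type) [Field L] [NumberField L] [IsCMField L]
  [MeasurableSpace (quasiSplit (↥(maximalRealSubfield L)) L (IsCMField.complexConj L) 3).Adelic] [BorelSpace (quasiSplit (↥(maximalRealSubfield L)) L (IsCMField.complexConj L) 3).Adelic]

/-- **THE MEROMORPHIC CONTINUATION OF THE SPHERICAL BOREL EISENSTEIN SERIES ON `U(2,1)_{L/L⁺}` TO ALL OF `ℂ`, MODULO K2's CUSP-DECAY LETTER `hK1`** [BernsteinLapid2019, Thm 2.3, §4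
Claims 1–5] (module docstring): `∃ Ec, (∀ g, MeromorphicOn (Ec · g) univ) ∧ ∀ z, 2 < Re z → Ec z = E(φ₀H^z)`.
[cite: BernsteinLapid2019, Thm 2.3, §2.4 and §4 Claims 1–5 (pp. 9–10)] [cite: Langlands1976, §7] [cite: MoeglinWaldspurger1995, IV.1.8–IV.1.10] -/
theorem sphericalEisenstein_meromorphic_cm_three_of_hK1
    -- structural letters: the measures
    (μ : Measure (quasiSplit (↥(maximalRealSubfield L)) L (IsCMField.complexConj L) 3).automorphicQuotient) [(quasiSplit (↥(maximalRealSubfield L)) L (IsCMField.complexConj L) 3).IsAutomorphicMeasure μ]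
    (νG : Measure (quasiSplit (↥(maximalRealSubfield L)) L (IsCMField.complexConj L) 3).Adelic) [νG.IsHaarMeasure] [νG.IsInvInvariant] [SFinite νG]
    (ν : Measure ↥(adelicUnipotent (↥(maximalRealSubfield L)) L (IsCMField.complexConj L) 3)) [ν.IsHaarMeasure] [ν.IsMulRightInvariant] [ν.IsInvInvariant]
    {𝓕 : Set ↥(adelicUnipotent (↥(maximalRealSubfield L)) L (IsCMField.complexConj L) 3)}
    (h𝓕N : IsFundamentalDomain ↥(rationalUnipotent (↥(maximalRealSubfield L)) L (IsCMField.complexConj L) 3) 𝓕 ν) (h𝓕c : IsCompact (closure 𝓕)) (h𝓕₀ : ν 𝓕 ≠ 0)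
    {β : (quasiSplit (↥(maximalRealSubfield L)) L (IsCMField.complexConj L) 3).Adelic → ℝ≥0∞}
    (hβ : IsCoveringWeight ↥((arithmeticBorel (↥(maximalRealSubfield L)) L (IsCMField.complexConj L) 3).map (quasiSplit (↥(maximalRealSubfield L)) L (IsCMField.complexConj L) 3).arithmeticSubgroup.subtype) β)
    {μZ : Measure (borelQuotient (↥(maximalRealSubfield L)) L (IsCMField.complexConj L) 3)} [SFinite μZ]
    (hμZ : ∀ f : borelQuotient (↥(maximalRealSubfield L)) L (IsCMField.complexConj L) 3 → ℝ≥0∞, Measurable f → ∫⁻ z, f z ∂μZ = ∫⁻ g, β g * f (toBorelQuotient (↥(maximalRealSubfield L)) L (IsCMField.complexConj L) 3 g) ∂νG)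
    -- THE letter: K2's cusp decay for the self-convolution test functions, at all levels
    (hK1 : ∀ η : GL (Fin 3) (AdeleRing (𝓞 L) L) → ℝ, IsTestFunctionGL 3 L η → (∀ g, 0 ≤ η g) → (∀ g, η g⁻¹ = η g) →
      (∀ k₁ k₂ : (quasiSplit (↥(maximalRealSubfield L)) L (IsCMField.complexConj L) 3).Adelic, adelicVal (↥(maximalRealSubfield L)) L (IsCMField.complexConj L) 3 ((StdForm.antidiagonal 3).over L) k₁ ∈ standardMaximalCompactGL 3 L → adelicVal (↥(maximalRealSubfield L)) L (IsCMField.complexConj L) 3 ((StdForm.antidiagonal 3).over L) k₂ ∈ standardMaximalCompactGL 3 L →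
          ∀ x, η (adelicVal (↥(maximalRealSubfield L)) L (IsCMField.complexConj L) 3 ((StdForm.antidiagonal 3).over L) (k₁ * x * k₂)) = η (adelicVal (↥(maximalRealSubfield L)) L (IsCMField.complexConj L) 3 ((StdForm.antidiagonal 3).over L) x)) →
      ∀ (k : ℕ) (c₁ c₀ κ : ℝ≥0), 0 < c₁ → 1 ≤ κ → κ * c₁ ≤ c₀ →
        (∀ z : borelQuotient (↥(maximalRealSubfield L)) L (IsCMField.complexConj L) 3, ∀ y ∈ tsupport (fun y : (quasiSplit (↥(maximalRealSubfield L)) L (IsCMField.complexConj L) 3).Adelic => orbitalSmoothing νG (fun x : (quasiSplit (↥(maximalRealSubfield L)) L (IsCMField.complexConj L) 3).Adelic => ((η (adelicVal (↥(maximalRealSubfield L)) L (IsCMField.complexConj L) 3 ((StdForm.antidiagonal 3).over L) x) : ℝ) : ℂ)) (fun x : (quasiSplit (↥(maximalRealSubfield L)) L (IsCMField.complexConj L) 3).Adelic => ((η (adelicVal (↥(maximalRealSubfield L)) L (IsCMField.complexConj L) 3 ((StdForm.antidiagonal 3).over L) x) : ℝ) : ℂ)) y), borelQuotHeight (↥(maximalRealSubfield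 L)) L (IsCMField.complexConj L) 3 z ≤ κ * borelQuotHeight (↥(maximalRealSubfield L)) L (IsCMField.complexConj L) 3 (rightShift (↥(maximalRealSubfield L)) L (IsCMField.complexConj L) 3 y z)) →
        ∃ m C : ℝ, 0 ≤ m ∧ 0 ≤ C ∧ ∀ f : HNcusp (↥(maximalRealSubfield L)) L (IsCMField.complexConj L) 3 k c₁ μZ, ∀ᵐ z ∂(weightedTruncMeasure (↥(maximalRealSubfield L)) L (IsCMField.complexConj L) 3 k c₀ μZ),
          ‖rightConvFun (↥(maximalRealSubfield L)) L (IsCMField.complexConj L) 3 νG (fun y : (quasiSplit (↥(maximalRealSubfield L)) L (IsCMField.complexConj L) 3).Adelic => orbitalSmoothing νG (fun x : (quasiSplit (↥(maximalRealSubfield L)) L (IsCMField.complexConj L) 3).Adelic => ((η (adelicVal (↥(maximalRealSubfield L)) L (IsCMField.complexConj L) 3 ((StdForm.antidiagonal 3).over L) x) : ℝ) : ℂ)) (fun x : (quasiSplit (↥(maximalRealSubfield L)) L (IsCMField.complexConj L) 3).Adelic => ((η (adelicVal (↥(maximalRealSubfield L)) L (IsCMField.complexConj L) 3 ((StdForm.antidiagonal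 3).over L) x) : ℝ) : ℂ)) y) ((f : HN (↥(maximalRealSubfield L)) L (IsCMField.complexConj L) 3 k c₁ μZ) : borelQuotient (↥(maximalRealSubfield L)) L (IsCMField.complexConj L) 3 → ℂ) z‖ ≤ C * ‖f‖ * ((borelQuotHeight (↥(maximalRealSubfield L)) L (IsCMField.complexConj L) 3 z : ℝ)) ^ (-m))
    (φ₀ : ℂ) :
    ∃ Ec : ℂ → (quasiSplit (↥(maximalRealSubfield L)) L (IsCMField.complexConj L) 3).Adelic → ℂ,
      (∀ g, MeromorphicOn (fun z => Ec z g) univ) ∧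
      ∀ z : ℂ, 2 < z.re → Ec z = eisensteinSeriesU (flatSectionU (fun _ : (quasiSplit (↥(maximalRealSubfield L)) L (IsCMField.complexConj L) 3).Adelic => φ₀) z) := by
  classical
  -- involution facts and a non-zero trace-zero element of `L`
  have hc : IsCMField.complexConj L * IsCMField.complexConj L = 1 :=
    AlgEquiv.ext fun x => by rw [AlgEquiv.mul_apply, AlgEquiv.one_apply, IsCMField.complexConj_apply_apply]
  have hc1 : IsCMField.complexConj L ≠ 1 := IsCMField.complexConj_ne_one L
  have h𝓕top : ν 𝓕 ≠ ∞ := ((measure_mono subset_closure).trans_lt h𝓕c.measure_lt_top).ne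
  haveI : νG.IsMulRightInvariant := by rw [← Measure.inv_eq_self νG]; infer_instance
  have hright := measurePreserving_rightShift_of_unfolding νG hβ hμZ
  -- exhaustion by the balls `n ≥ 1` (★ (a) `…_of_eventually_balls_cm_three`)
  refine sphericalEisenstein_meromorphic_of_eventually_balls_cm_three (L := L) φ₀ 1 le_rfl fun n hn1 g => ?_
  have hn : 0 < n := hn1
  have hk : (n : ℝ) + 2 + 2 ≤ ((n + 4 : ℕ) : ℝ) := by push_cast; linarith
  have hk4 : (n : ℝ) + 4 ≤ ((n + 4 : ℕ) : ℝ) := by push_cast; exact le_rfl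
  -- the structural data of the ball (★ `exists_convData_cm_three`)
  obtain ⟨a, ha, I, hIf, i₀, η, κ, T, hη, hconv, h1, hcov, hĥ₀, hκ, hcmp, hι, hne, hT, hpack⟩ := exists_convData_cm_three L μ νG hβ hμZ n
  choose hpos hinj hcl using hι
  choose hs hδι using hpack
  have hb : IotaBound (↥(maximalRealSubfield L)) L (IsCMField.complexConj L) 3 (n + 4) a μ μZ := iotaBound_cm_three L μ νG hβ hμZ ha (n + 4)
  have hfin : μZ {z | a < borelQuotHeight (↥(maximalRealSubfield L)) L (IsCMField.complexConj L) 3 z} ≠ ∞ := measure_setOf_lt_ne_top_cm_three L μ νG hβ hμZ ha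
  haveI : IsFiniteMeasure (weightedTruncMeasure (↥(maximalRealSubfield L)) L (IsCMField.complexConj L) 3 (n + 4) a μZ) := isFiniteMeasure_weightedTruncMeasure_cm_three L μ νG hβ hμZ ha (n + 4)
  have hfin₀ : ∀ i, IsFiniteMeasure (weightedTruncMeasure (↥(maximalRealSubfield L)) L (IsCMField.complexConj L) 3 (n + 4) (κ i * a) μZ) := fun i =>
    isFiniteMeasure_weightedTruncMeasure_cm_three L μ νG hβ hμZ (hpos i) (n + 4)
  -- K2's letter at the system levels `(a, κ_i a)`
  have hK1i : ∀ i, ∃ m C : ℝ, 0 ≤ m ∧ 0 ≤ C ∧ ∀ f : HNcusp (↥(maximalRealSubfield L)) L (IsCMField.complexConj L) 3 (n + 4) a μZ, ∀ᵐ z ∂(weightedTruncMeasure (↥(maximalRealSubfield L)) L (IsCMField.complexConj L) 3 (n + 4) (κ i * a) μZ),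
      ‖rightConvFun (↥(maximalRealSubfield L)) L (IsCMField.complexConj L) 3 νG ((fun (i : I) (y : (quasiSplit (↥(maximalRealSubfield L)) L (IsCMField.complexConj L) 3).Adelic) => orbitalSmoothing νG (fun x : (quasiSplit (↥(maximalRealSubfield L)) L (IsCMField.complexConj L) 3).Adelic => ((η i (adelicVal (↥(maximalRealSubfield L)) L (IsCMField.complexConj L) 3 ((StdForm.antidiagonal 3).over L) x) : ℝ) : ℂ)) (fun x : (quasiSplit (↥(maximalRealSubfield L)) L (IsCMField.complexConj L) 3).Adelic => ((η i (adelicVal (↥(maximalRealSubfield L)) L (IsCMField.complexConj L) 3 ((StdForm.antidiagonal 3).over L) x) : ℝ) : ℂ)) y) i) ((f : HN (↥(maximalRealSubfield L)) L (IsCMField.complexConj L) 3 (n + 4) a μZ) : borelQuotient (↥(maximalRealSubfield L)) L (IsCMField.complexConj L) 3 → ℂ) z‖ ≤ C * ‖f‖ * ((borelQuotHeight (↥(maximalRealSubfield L)) L (IsCMField.complexConj L) 3 z : ℝ)) ^ (-m) := fun i =>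
    hK1 (η i) (hη i).1 (hη i).2.1 (hη i).2.2.1 (hη i).2.2.2 (n + 4) a (κ i * a) (κ i) ha (hκ i).1 le_rfl (hcmp i)
  choose m C hm hC hK1' using hK1i
  -- the constant-term vectors (★ ℓ7)
  obtain ⟨α₁, α₂, hα₁, hα₂, -, hα₂ne⟩ := exists_constantTermVectors_two_sub (F := ↥(maximalRealSubfield L)) (E := L) (c := IsCMField.complexConj L) (N := 3)
    (k := n + 4) (μZ := μZ) n hk4 ha hfin hne
  have hα₂' : ∀ z ∈ Metric.ball (0 : ℂ) (n + 2), (α₂ z : borelQuotient (↥(maximalRealSubfield L)) L (IsCMField.complexConj L) 3 → ℂ) =ᵐ[weightedTruncMeasure (↥(maximalRealSubfield L)) L (IsCMField.complexConj L) 3 (n + 4) a μZ]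
      fun x => (((borelQuotHeight (↥(maximalRealSubfield L)) L (IsCMField.complexConj L) 3 x : ℝ≥0) : ℝ) : ℂ) ^ (((2 : ℝ) : ℂ) - z) := fun z hz => by
    simpa only [Complex.ofReal_ofNat] using hα₂ z hz
  -- the identification `zFun (H^w) = HZ^w`
  have hzF : ∀ w : ℂ, zFun (↥(maximalRealSubfield L)) L (IsCMField.complexConj L) 3 (fun g : (quasiSplit (↥(maximalRealSubfield L)) L (IsCMField.complexConj L) 3).Adelic => (((borelHeight g : ℝ)) : ℂ) ^ w) = fun x => (((borelQuotHeight (↥(maximalRealSubfield L)) L (IsCMField.complexConj L) 3 x : ℝ≥0) : ℝ) : ℂ) ^ w := by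
    intro w
    funext x
    obtain ⟨g₁, rfl⟩ : ∃ g₁, toBorelQuotient (↥(maximalRealSubfield L)) L (IsCMField.complexConj L) 3 g₁ = x := Quotient.exists_rep x
    refine zFun_toBorelQuotient (↥(maximalRealSubfield L)) L (IsCMField.complexConj L) 3 (fun γ hγ g' => ?_) g₁
    obtain ⟨γ₀, hγ₀, hγ₀B⟩ := exists_eq_toAdelic_of_mem_ratBorelSubgroup (↥(maximalRealSubfield L)) L (IsCMField.complexConj L) 3 hγ
    simp only [← hγ₀, borelHeight_rational_borel_mul γ₀ hγ₀B]
  -- the Eisenstein data on the Godement part of the ball ((b1), S1, S2)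
  have hzk : ∀ z ∈ Metric.ball (0 : ℂ) (n + 2), z.re ≤ ((n + 4 : ℕ) : ℝ) := fun z hz => by
    have h1 : z.re ≤ ‖z‖ := Complex.re_le_norm z
    have h2 : ‖z‖ < n + 2 := mem_ball_zero_iff.1 hz
    push_cast
    linarith
  have hE : ∀ z : ℂ, z ∈ Metric.ball (0 : ℂ) (n + 2) ∧ 2 < z.re → MemLp ((quasiSplit (↥(maximalRealSubfield L)) L (IsCMField.complexConj L) 3).quotFun (eisensteinSeriesU (flatSectionU (fun _ : (quasiSplit (↥(maximalRealSubfield L)) L (IsCMField.complexConj L) 3).Adelic => φ₀) z))) 2 (μ.withDensity fun x => (((supHeight (↥(maximalRealSubfield L)) L (IsCMField.complexConj L) 3 x)⁻¹ ^ (2 * (n + 4)) : ℝ≥0) : ℝ≥0∞)) := fun z hz =>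
    eisensteinSeriesU_flatSectionU_memHX_cm_three L ν h𝓕N h𝓕c μ φ₀ (n + 4) hz.2 (hzk z hz.1)
  have hαF₁ : ∀ z ∈ Metric.ball (0 : ℂ) (n + 2), MemLp (zFun (↥(maximalRealSubfield L)) L (IsCMField.complexConj L) 3 (fun g : (quasiSplit (↥(maximalRealSubfield L)) L (IsCMField.complexConj L) 3).Adelic => (((borelHeight g : ℝ)) : ℂ) ^ z)) 2
      (weightedTruncMeasure (↥(maximalRealSubfield L)) L (IsCMField.complexConj L) 3 (n + 4) a μZ) := fun z hz => by
    rw [hzF]; exact (Lp.memLp (α₁ z)).ae_eq (hα₁ z hz)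
  have hαF₂ : ∀ z ∈ Metric.ball (0 : ℂ) (n + 2), MemLp (zFun (↥(maximalRealSubfield L)) L (IsCMField.complexConj L) 3 (fun g : (quasiSplit (↥(maximalRealSubfield L)) L (IsCMField.complexConj L) 3).Adelic => (((borelHeight g : ℝ)) : ℂ) ^ (2 - z))) 2
      (weightedTruncMeasure (↥(maximalRealSubfield L)) L (IsCMField.complexConj L) 3 (n + 4) a μZ) := fun z hz => by
    rw [hzF]; exact (Lp.memLp (α₂ z)).ae_eq (hα₂ z hz)
  have htoHN₁ : ∀ z (hz : z ∈ Metric.ball (0 : ℂ) (n + 2)),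
      toHN (↥(maximalRealSubfield L)) L (IsCMField.complexConj L) 3 (n + 4) a μZ (fun g : (quasiSplit (↥(maximalRealSubfield L)) L (IsCMField.complexConj L) 3).Adelic => (((borelHeight g : ℝ)) : ℂ) ^ z) (hαF₁ z hz) = α₁ z := fun z hz =>
    Lp.ext ((coeFn_toHN (↥(maximalRealSubfield L)) L (IsCMField.complexConj L) 3 (n + 4) a μZ _ (hαF₁ z hz)).trans (by rw [hzF]; exact (hα₁ z hz).symm))
  have htoHN₂ : ∀ z (hz : z ∈ Metric.ball (0 : ℂ) (n + 2)),
      toHN (↥(maximalRealSubfield L)) L (IsCMField.complexConj L) 3 (n + 4) a μZ (fun g : (quasiSplit (↥(maximalRealSubfield L)) L (IsCMField.complexConj L) 3).Adelic => (((borelHeight g : ℝ)) : ℂ) ^ (2 - z)) (hαF₂ z hz) = α₂ z := fun z hz =>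
    Lp.ext ((coeFn_toHN (↥(maximalRealSubfield L)) L (IsCMField.complexConj L) 3 (n + 4) a μZ _ (hαF₂ z hz)).trans (by rw [hzF]; exact (hα₂ z hz).symm))
  -- the disintegration letter of S2, paid by ★ `integral_zFun_borelConstantTerm_eq_of_unfolding` (`hconj` ★ at `N = 2`)
  have hdis' : ∀ Φ : (quasiSplit (↥(maximalRealSubfield L)) L (IsCMField.complexConj L) 3).Adelic → ℂ, Measurable Φ → (∀ b ∈ ratBorelSubgroup (↥(maximalRealSubfield L)) L (IsCMField.complexConj L) 3, ∀ g, Φ (b * g) = Φ g) →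
      Integrable (zFun (↥(maximalRealSubfield L)) L (IsCMField.complexConj L) 3 Φ) (weightedTruncMeasure (↥(maximalRealSubfield L)) L (IsCMField.complexConj L) 3 (n + 4) a μZ) →
      Integrable (zFun (↥(maximalRealSubfield L)) L (IsCMField.complexConj L) 3 (borelConstantTerm ν 𝓕 Φ)) (weightedTruncMeasure (↥(maximalRealSubfield L)) L (IsCMField.complexConj L) 3 (n + 4) a μZ) →
        ∫ x, zFun (↥(maximalRealSubfield L)) L (IsCMField.complexConj L) 3 (borelConstantTerm ν 𝓕 Φ) x ∂(weightedTruncMeasure (↥(maximalRealSubfield L)) L (IsCMField.complexConj L) 3 (n + 4) a μZ) =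
          ∫ x, zFun (↥(maximalRealSubfield L)) L (IsCMField.complexConj L) 3 Φ x ∂(weightedTruncMeasure (↥(maximalRealSubfield L)) L (IsCMField.complexConj L) 3 (n + 4) a μZ) := fun Φ hΦm hΦB hint hint' =>
    integral_zFun_borelConstantTerm_eq_of_unfolding νG ν (fun _ hb₀ => map_conj_toAdelic_eq_self_three hc hc1 ν hb₀) h𝓕N h𝓕₀ h𝓕top hβ hμZ (n + 4) a
      hΦm hΦB hint hint'
  have hS2 : ∀ z (hz : z ∈ Metric.ball (0 : ℂ) (n + 2) ∧ 2 < z.re), ∃ b : ℂ,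
      cnstN (↥(maximalRealSubfield L)) L (IsCMField.complexConj L) 3 (n + 4) a μZ (iota hb (toHX (↥(maximalRealSubfield L)) L (IsCMField.complexConj L) 3 (n + 4) μ (eisensteinSeriesU (flatSectionU (fun _ : (quasiSplit (↥(maximalRealSubfield L)) L (IsCMField.complexConj L) 3).Adelic => φ₀) z)) (hE z hz))) = φ₀ • α₁ z + b • α₂ z := fun z hz => by
    obtain ⟨b, hb'⟩ := exists_cnstN_iota_toHX_eisensteinSeriesU_eq_cm_three L ν h𝓕N h𝓕c hb hdis' φ₀ hz.2 (hE z hz) (hαF₁ z hz.1) (hαF₂ z hz.1)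
    rw [htoHN₁ z hz.1, htoHN₂ z hz.1] at hb'
    exact ⟨b, hb'⟩
  choose bX' hbX' using hS2
  -- the solution pair `(eX, bX)` (zero off the Godement part of the ball)
  obtain ⟨eX, heX⟩ : ∃ eX : ℂ → HX (↥(maximalRealSubfield L)) L (IsCMField.complexConj L) 3 (n + 4) μ, eX = fun z =>
      if hz : z ∈ Metric.ball (0 : ℂ) (n + 2) ∧ 2 < z.re then toHX (↥(maximalRealSubfield L)) L (IsCMField.complexConj L) 3 (n + 4) μ (eisensteinSeriesU (flatSectionU (fun _ : (quasiSplit (↥(maximalRealSubfield L)) L (IsCMField.complexConj L) 3).Adelic => φ₀) z)) (hE z hz) else 0 := ⟨_, rfl⟩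
  obtain ⟨bX, hbX⟩ : ∃ bX : ℂ → ℂ, bX = fun z => if hz : z ∈ Metric.ball (0 : ℂ) (n + 2) ∧ 2 < z.re then bX' z hz else 0 := ⟨_, rfl⟩
  have heXz : ∀ z (hz : z ∈ Metric.ball (0 : ℂ) (n + 2) ∧ 2 < z.re), eX z = toHX (↥(maximalRealSubfield L)) L (IsCMField.complexConj L) 3 (n + 4) μ (eisensteinSeriesU (flatSectionU (fun _ : (quasiSplit (↥(maximalRealSubfield L)) L (IsCMField.complexConj L) 3).Adelic => φ₀) z)) (hE z hz) := fun z hz => by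
    rw [heX]; exact dif_pos hz
  have hsolT : ∀ z ∈ Metric.ball (0 : ℂ) (n + 2), 2 < z.re → ∀ i,
      T i (eX z) = (∫ x, (fun (i : I) (y : (quasiSplit (↥(maximalRealSubfield L)) L (IsCMField.complexConj L) 3).Adelic) => orbitalSmoothing νG (fun x : (quasiSplit (↥(maximalRealSubfield L)) L (IsCMField.complexConj L) 3).Adelic => ((η i (adelicVal (↥(maximalRealSubfield L)) L (IsCMField.complexConj L) 3 ((StdForm.antidiagonal 3).over L) x) : ℝ) : ℂ)) (fun x : (quasiSplit (↥(maximalRealSubfield L)) L (IsCMField.complexConj L) 3).Adelic => ((η i (adelicVal (↥(maximalRealSubfield L)) L (IsCMField.complexConj L) 3 ((StdForm.antidiagonal 3).over L) x) : ℝ) : ℂ)) y) i x * (((borelHeight x : ℝ≥0) : ℝ) : ℂ) ^ z ∂νG) • eX z := fun z hz hz1 i => by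
    rw [heXz z ⟨hz, hz1⟩]
    exact shiftOperatorX_toHX_eisensteinSeriesU_eq_smul_cm_three L μ νG (hconv i).2.2.1 (hconv i).1 (hconv i).2.1 φ₀ hz1 (hE z ⟨hz, hz1⟩) (T i) (hT i)
  have hsolC : ∀ z ∈ Metric.ball (0 : ℂ) (n + 2), 2 < z.re →
      cnstN (↥(maximalRealSubfield L)) L (IsCMField.complexConj L) 3 (n + 4) a μZ (iota hb (eX z)) = φ₀ • α₁ z + bX z • α₂ z := fun z hz hz1 => by
    rw [heXz z ⟨hz, hz1⟩, hbX]
    dsimp only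
    rw [dif_pos ⟨hz, hz1⟩]
    exact hbX' z ⟨hz, hz1⟩
  have hsolQ : ∀ z ∈ Metric.ball (0 : ℂ) (n + 2), 2 < z.re → (0 : HX (↥(maximalRealSubfield L)) L (IsCMField.complexConj L) 3 (n + 4) μ →L[ℂ] HX (↥(maximalRealSubfield L)) L (IsCMField.complexConj L) 3 (n + 4) μ) (eX z) = 0 := fun _ _ _ => rfl
  -- the essential bound of `δ(α₂ z)` (★ payer) and the uniqueness letter (★ P6′ one-call)
  have hδα₂ : ∀ z ∈ Metric.ball (0 : ℂ) (n + 2), 2 < z.re → ∃ M : ℝ, ∀ᵐ x ∂(weightedTruncMeasure (↥(maximalRealSubfield L)) L (IsCMField.complexConj L) 3 (n + 4) (κ i₀ * a) μZ),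
      ‖(deltaShift (hs i₀) (α₂ z) : borelQuotient (↥(maximalRealSubfield L)) L (IsCMField.complexConj L) 3 → ℂ) x‖ ≤ M := fun z hz hz1 =>
    exists_ae_norm_deltaShift_le_of_ae_eq_cpow hright (isClosed_tsupport _).measurableSet (lt_of_lt_of_le zero_lt_one (hκ i₀).1) le_rfl (hcmp i₀)
      (fun y hy => image_eq_zero_of_notMem_tsupport hy) ((hconv i₀).1.integrable_of_hasCompactSupport (hconv i₀).2.1) (hs i₀) ha (hα₂ z hz)
      (by rw [Complex.sub_re, Complex.re_ofNat]; linarith)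
  have hunq := hunq_cm_three L μ νG hβ hμZ (n + 4) n hn i₀ (h := (fun (i : I) (y : (quasiSplit (↥(maximalRealSubfield L)) L (IsCMField.complexConj L) 3).Adelic) => orbitalSmoothing νG (fun x : (quasiSplit (↥(maximalRealSubfield L)) L (IsCMField.complexConj L) 3).Adelic => ((η i (adelicVal (↥(maximalRealSubfield L)) L (IsCMField.complexConj L) 3 ((StdForm.antidiagonal 3).over L) x) : ℝ) : ℂ)) (fun x : (quasiSplit (↥(maximalRealSubfield L)) L (IsCMField.complexConj L) 3).Adelic => ((η i (adelicVal (↥(maximalRealSubfield L)) L (IsCMField.complexConj L) 3 ((StdForm.antidiagonal 3).over L) x) : ℝ) : ℂ)) y)) (fun i => (hconv i).1) (fun i => (hconv i).2.1) (hconv i₀).2.2.2.1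
    (hconv i₀).2.2.2.2.1 (hconv i₀).2.2.2.2.2 h1 (hpos i₀) (hκ i₀).2 hfin hb (hs i₀) T (hT i₀) (hδι i₀ (hκ i₀).2) (hC i₀) (hm i₀) (hK1' i₀) α₁ α₂ hδα₂
    (0 : HX (↥(maximalRealSubfield L)) L (IsCMField.complexConj L) 3 (n + 4) μ →L[ℂ] HX (↥(maximalRealSubfield L)) L (IsCMField.complexConj L) 3 (n + 4) μ) φ₀ eX bX hsolT hsolC hsolQ
  -- the evaluation functional (★ P3-D, on the real test function `Re h_{i₀} = h_{i₀}`)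
  have hre : ∀ x, ((((fun (i : I) (y : (quasiSplit (↥(maximalRealSubfield L)) L (IsCMField.complexConj L) 3).Adelic) => orbitalSmoothing νG (fun x : (quasiSplit (↥(maximalRealSubfield L)) L (IsCMField.complexConj L) 3).Adelic => ((η i (adelicVal (↥(maximalRealSubfield L)) L (IsCMField.complexConj L) 3 ((StdForm.antidiagonal 3).over L) x) : ℝ) : ℂ)) (fun x : (quasiSplit (↥(maximalRealSubfield L)) L (IsCMField.complexConj L) 3).Adelic => ((η i (adelicVal (↥(maximalRealSubfield L)) L (IsCMField.complexConj L) 3 ((StdForm.antidiagonal 3).over L) x) : ℝ) : ℂ)) y) i₀ x).re : ℝ) : ℂ) = (fun (i : I) (y : (quasiSplit (↥(maximalRealSubfield L)) L (IsCMField.complexConj L) 3).Adelic) => orbitalSmoothing νG (fun x : (quasiSplit (↥(maximalRealSubfield L)) L (IsCMField.complexConj L) 3).Adelic => ((η i (adelicVal (↥(maximalRealSubfield L)) L (IsCMField.complexConj L) 3 ((StdForm.antidiagonal 3).over L) x) : ℝ) : ℂ)) (fun x : (quasiSplit (↥(maximalRealSubfield L)) L (IsCMField.complexConj L) 3).Adelic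 => ((η i (adelicVal (↥(maximalRealSubfield L)) L (IsCMField.complexConj L) 3 ((StdForm.antidiagonal 3).over L) x) : ℝ) : ℂ)) y) i₀ x := fun x => Complex.conj_eq_iff_re.1 ((hconv i₀).2.2.2.2.1 x)
  obtain ⟨Λ, hΛ⟩ := exists_evalCLM_eisenstein_cm_three L μ νG (n + 4) (h := fun x => ((fun (i : I) (y : (quasiSplit (↥(maximalRealSubfield L)) L (IsCMField.complexConj L) 3).Adelic) => orbitalSmoothing νG (fun x : (quasiSplit (↥(maximalRealSubfield L)) L (IsCMField.complexConj L) 3).Adelic => ((η i (adelicVal (↥(maximalRealSubfield L)) L (IsCMField.complexConj L) 3 ((StdForm.antidiagonal 3).over L) x) : ℝ) : ℂ)) (fun x : (quasiSplit (↥(maximalRealSubfield L)) L (IsCMField.complexConj L) 3).Adelic => ((η i (adelicVal (↥(maximalRealSubfield L)) L (IsCMField.complexConj L) 3 ((StdForm.antidiagonal 3).over L) x) : ℝ) : ℂ)) y) i₀ x).re)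
    (fun k₀ hk₀ x => by simp only [(hconv i₀).2.2.1 k₀ hk₀ x]) (Complex.continuous_re.comp (hconv i₀).1)
    ((hconv i₀).2.1.comp_left Complex.zero_re) φ₀ g
  have hΛ' : ∀ z ∈ Metric.ball (0 : ℂ) (n + 2), 2 < z.re →
      Λ (eX z) = (∫ x, (fun (i : I) (y : (quasiSplit (↥(maximalRealSubfield L)) L (IsCMField.complexConj L) 3).Adelic) => orbitalSmoothing νG (fun x : (quasiSplit (↥(maximalRealSubfield L)) L (IsCMField.complexConj L) 3).Adelic => ((η i (adelicVal (↥(maximalRealSubfield L)) L (IsCMField.complexConj L) 3 ((StdForm.antidiagonal 3).over L) x) : ℝ) : ℂ)) (fun x : (quasiSplit (↥(maximalRealSubfield L)) L (IsCMField.complexConj L) 3).Adelic => ((η i (adelicVal (↥(maximalRealSubfield L)) L (IsCMField.complexConj L) 3 ((StdForm.antidiagonal 3).over L) x) : ℝ) : ℂ)) y) i₀ x * (((borelHeight x : ℝ≥0) : ℝ) : ℂ) ^ z ∂νG) * eisensteinSeriesU (flatSectionU (fun _ : (quasiSplit (↥(maximalRealSubfield L)) L (IsCMField.complexConj L) 3).Adelic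 => φ₀) z) g := by
    intro z hz hz1
    rw [heXz z ⟨hz, hz1⟩, hΛ z hz1 (hE z ⟨hz, hz1⟩)]
    simp only [hre]
  -- ★ §2 on the ball
  exact sphericalEisenstein_meromorphicOn_ball_of_letters_of_lt 2 2 zero_le_two n (n + 4) hk νG i₀ ha (a₀ := fun i => κ i * a) (fun i => (hκ i).2) hfin (hfin₀ := hfin₀) hb
    (fun i => iotaBound_cm_three L μ νG hβ hμZ (hpos i) (n + 4)) hcl hinj (fun (i : I) (y : (quasiSplit (↥(maximalRealSubfield L)) L (IsCMField.complexConj L) 3).Adelic) => orbitalSmoothing νG (fun x : (quasiSplit (↥(maximalRealSubfield L)) L (IsCMField.complexConj L) 3).Adelic => ((η i (adelicVal (↥(maximalRealSubfield L)) L (IsCMField.complexConj L) 3 ((StdForm.antidiagonal 3).over L) x) : ℝ) : ℂ)) (fun x : (quasiSplit (↥(maximalRealSubfield L)) L (IsCMField.complexConj L) 3).Adelic => ((η i (adelicVal (↥(maximalRealSubfield L)) L (IsCMField.complexConj L) 3 ((StdForm.antidiagonal 3).over L) x) : ℝ) : ℂ)) y) (fun i => (hconv i).1) (fun i => (hconv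 i).2.1) hcov
    ⟨0, Metric.mem_ball_self (by positivity), hĥ₀⟩ hs hm hC hK1' T (fun i => hδι i (hκ i).2) hα₁ hα₂' hα₂ne
    (0 : HX (↥(maximalRealSubfield L)) L (IsCMField.complexConj L) 3 (n + 4) μ →L[ℂ] HX (↥(maximalRealSubfield L)) L (IsCMField.complexConj L) 3 (n + 4) μ) φ₀ eX bX hsolT hsolC hsolQ hunq g Λ hΛ'


/-- **ED. 2 — THE MEROMORPHIC CONTINUATION OF THE SPHERICAL BOREL EISENSTEIN SERIES ON `U(2,1)_{L/L⁺}` TO ALL OF `ℂ`, K2's CUSP-DECAY LETTER `hK1` PAID** (K2E1-p13 (g0), on K2E1-p09's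
hand-over 2026-09-04T10:25:54Z): ★ `sphericalEisenstein_meromorphic_cm_three_of_hK1` with its single analytic letter `hK1` DISCHARGED by ★ p859367 `K2E1TruncatedCuspDecayHK1CMThree.hK1_cm_three`
(K1₃-L² chain ★ p859309 on ★ ENGINE₃ ∘ ★ FILE 1 mass growth ∘ ★ BAND₃ p859310 ∘ ★ combinator p859263 ∘ K2-defs1's every-rank constant-term a.e. vanishing ★ p859335), at `m := 1`,
`c₀ ≥ κ·c₁ ≥ c₁ > 0`; the Borel structure on `𝔸_L` is chosen inside (`borel`), `ν_G` is right-invariant as an inversion-invariant Haar measure.  What remains displayed is STRUCTURAL only: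
the automorphic measure `μ`, the Haar measures `ν_G` (inversion-invariant, s-finite) and `ν` on the Heisenberg radical with a relatively compact fundamental domain `𝓕` of positive measure, and
the measure letters of record `hβ`∕`hμZ` (dealer RULING D2; inhabited by K2E1-p10's `K2E1SphericalEisensteinStructuralDataCMThree`).  CONCLUSION: `∃ Ec, (∀ g, MeromorphicOn (Ec · g) univ) ∧
∀ z, 2 < Re z → Ec z = E(φ₀H^z)` — «(R7-sph)₃»: the spherical Borel Eisenstein series of `U(2,1)` over a CM field has a whole-plane meromorphic continuation in `z` for every `g`, NO analytic
letter left. [cite: BernsteinLapid2019, Thm 2.3, §2.4 and §4 Claims 1–5 (pp. 9–10)] [cite: Langlands1976, §7] [cite: MoeglinWaldspurger1995, IV.1.8–IV.1.10] -/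
theorem sphericalEisenstein_meromorphic_cm_three
    (μ : Measure (quasiSplit (↥(maximalRealSubfield L)) L (IsCMField.complexConj L) 3).automorphicQuotient) [(quasiSplit (↥(maximalRealSubfield L)) L (IsCMField.complexConj L) 3).IsAutomorphicMeasure μ]
    (νG : Measure (quasiSplit (↥(maximalRealSubfield L)) L (IsCMField.complexConj L) 3).Adelic) [νG.IsHaarMeasure] [νG.IsInvInvariant] [SFinite νG]
    (ν : Measure ↥(adelicUnipotent (↥(maximalRealSubfield L)) L (IsCMField.complexConj L) 3)) [ν.IsHaarMeasure] [ν.IsMulRightInvariant] [ν.IsInvInvariant]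
    {𝓕 : Set ↥(adelicUnipotent (↥(maximalRealSubfield L)) L (IsCMField.complexConj L) 3)}
    (h𝓕N : IsFundamentalDomain ↥(rationalUnipotent (↥(maximalRealSubfield L)) L (IsCMField.complexConj L) 3) 𝓕 ν) (h𝓕c : IsCompact (closure 𝓕)) (h𝓕₀ : ν 𝓕 ≠ 0)
    {β : (quasiSplit (↥(maximalRealSubfield L)) L (IsCMField.complexConj L) 3).Adelic → ℝ≥0∞}
    (hβ : IsCoveringWeight ↥((arithmeticBorel (↥(maximalRealSubfield L)) L (IsCMField.complexConj L) 3).map (quasiSplit (↥(maximalRealSubfield L)) L (IsCMField.complexConj L) 3).arithmeticSubgroup.subtype) β)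
    {μZ : Measure (borelQuotient (↥(maximalRealSubfield L)) L (IsCMField.complexConj L) 3)} [SFinite μZ]
    (hμZ : ∀ f : borelQuotient (↥(maximalRealSubfield L)) L (IsCMField.complexConj L) 3 → ℝ≥0∞, Measurable f → ∫⁻ z, f z ∂μZ = ∫⁻ g, β g * f (toBorelQuotient (↥(maximalRealSubfield L)) L (IsCMField.complexConj L) 3 g) ∂νG)
    (φ₀ : ℂ) :
    ∃ Ec : ℂ → (quasiSplit (↥(maximalRealSubfield L)) L (IsCMField.complexConj L) 3).Adelic → ℂ,
      (∀ g, MeromorphicOn (fun z => Ec z g) univ) ∧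
      ∀ z : ℂ, 2 < z.re → Ec z = eisensteinSeriesU (flatSectionU (fun _ : (quasiSplit (↥(maximalRealSubfield L)) L (IsCMField.complexConj L) 3).Adelic => φ₀) z) := by
  letI : MeasurableSpace (AdeleRing (𝓞 L) L) := borel _
  haveI : BorelSpace (AdeleRing (𝓞 L) L) := ⟨rfl⟩
  haveI : νG.IsMulRightInvariant := by rw [← Measure.inv_eq_self νG]; infer_instance
  refine sphericalEisenstein_meromorphic_cm_three_of_hK1 L μ νG ν h𝓕N h𝓕c h𝓕₀ hβ hμZ (fun η hη _ _ _ k c₁ c₀ κ hc₁ hκ1 hκc hΩ => ?_) φ₀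
  have hκ : 0 < κ := zero_lt_one.trans_le hκ1
  have hc₀ : 0 < c₀ := lt_of_lt_of_le (mul_pos hκ hc₁) hκc
  obtain ⟨C, hC, h⟩ := K2E1TruncatedCuspDecayHK1CMThree.hK1_cm_three L μZ νG hβ hμZ hη k c₁ c₀ hc₀ hκ hκc hΩ (m := 1) zero_le_one
  exact ⟨1, C, zero_le_one, hC, h⟩

end Summit.HodgeConjecture.HodgeConjecture.Cruxes.H413.K2E1SphericalEisensteinMeromorphicU3

end
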